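import Mathlib
import HarnessLib
import Literature.MathematicalPhysics.StatisticalMechanics.InitialActivityPerturbationBundled
import Literature.MathematicalPhysics.StatisticalMechanics.InitialActivityJointSecondDiffWeak

/-!
# The initial activity `y₀^{𝒦}(h) = K̂_0(𝒦, h)` has bounded JOINT second differences in `(𝒦, h)`:
# hypothesis `hμ12` of `RGFlow.secondDiff_initial_le_of_isTunedQ` for the torus data
# ([ABKM19] Lemma 12.2, `j₁ + j₂ = 2`, bundled form)

Continuation of `InitialActivityPerturbationBundled.lean` (first order) and
`InitialActivityJointSecondDiffWeak.lean` (`weakNormLE_initKH_jointSecondDiff`).  In the types of the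
fine-tuning engine (`initAct 𝒦 : E_0 → activitySpace P 0`, predicate `activityNormLE P 0`):

* **`activityNormLE_initAct_jointSecondDiff`** — for perturbations `𝒦, 𝒦+U, 𝒦+V, 𝒦+U+V` in the
  `ρ`-ball of `E_{1/2}` with `‖D^sU‖ ≤ ue^{|z|²/4}`, `‖D^sV‖ ≤ ve^{|z|²/4}`, and relevant seeds
  `x, x+y, x+z, x+y+z` of norm `≤ 1/64`, under the smallness of `weakNormLE_initKH_jointSecondDiff`:
  `‖y₀^{𝒦+U+V}(x+y+z) − y₀^{𝒦+U}(x+y) − y₀^{𝒦+V}(x+z) + y₀^{𝒦}(x)‖_0^{(A)}` is bounded by the bilinear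
  quantity of that theorem with `‖Y‖ = ‖y‖`, `‖Z‖ = ‖z‖`.

Everything is proved; no named fact.

## References
* S. Adams, S. Buchholz, R. Kotecký, S. Müller, arXiv:1910.13564, Lemma 12.2 (12.9), Lemma 12.6,
  Theorem 2.2 [AdamsBuchholzKoteckyMuller2019].
-/

noncomputable section

namespace Literature.MathematicalPhysics.StatisticalMechanics.GradientRG

open scoped BigOperators Classical
open Finset Matrix
open Literature.MathematicalPhysics.QuantumFieldTheory

variable {d M : ℕ} [NeZero M]

section Bundled

variable {L N Mord R n p r₀ : ℕ} {θbar lam μ δ₁ δ₀ A𝒫 h A : ℝ} {𝒞 : ℕ → (Fin d → ZMod M) → ℝ}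

/-- **Hypothesis `hμ12` of `RGFlow.secondDiff_initial_le_of_isTunedQ` for the torus data** ([ABKM19]
Lemma 12.2 at total order two, bundled): joint mixed second differences of `(𝒦, h) ↦ y₀^{𝒦}(h)` in
`‖·‖_0^{(A)}`, bilinear in the increments and uniform in the volume.
[cite: AdamsBuchholzKoteckyMuller2019, Lemma 12.2 (12.9) / Lemma 12.6] -/
theorem activityNormLE_initAct_jointSecondDiff
    [∀ j : ℕ, Fact (0 < fieldWt h (L : ℝ) d j)] [∀ j : ℕ, Fact (0 < (L : ℝ) ^ j)] [∀ j : ℕ, Fact (0 < L ^ (d * j))]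
    (hd : 2 ≤ d) (hLodd : Odd L) (hM : M = L ^ N)
    (hp : d / 2 + 1 ≤ p) (hMord : d / 2 + 1 ≤ Mord)
    (hB : AbkmWeightBounds L N Mord R n θbar lam μ δ₁ δ₀ A𝒫 𝒞
      (abkmWeightData L N Mord R θbar (schedDelta δ₀ δ₁ N) 𝒞))
    (hδ₀ : 0 < δ₀) (hδ₁ : 0 < δ₁) (hh : 0 < h) (hh0 : hZeroSq d R δ₀ δ₁ ≤ h ^ 2) (hA : 0 < A)
    {𝒦 U V : (Fin d → ℝ) → ℂ} {ρ u v : ℝ}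
    (h𝒦 : ContDiff ℝ r₀ 𝒦) (hU : ContDiff ℝ r₀ U) (hV : ContDiff ℝ r₀ V)
    (h𝒦b : ∀ k, k ≤ r₀ → ∀ z : Fin d → ℝ, ‖iteratedFDeriv ℝ k 𝒦 z‖ ≤ ρ * Real.exp ((∑ i, z i ^ 2) / 4))
    (h𝒦Ub : ∀ k, k ≤ r₀ → ∀ z : Fin d → ℝ,
      ‖iteratedFDeriv ℝ k (fun z => 𝒦 z + U z) z‖ ≤ ρ * Real.exp ((∑ i, z i ^ 2) / 4))
    (h𝒦Vb : ∀ k, k ≤ r₀ → ∀ z : Fin d → ℝ,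
      ‖iteratedFDeriv ℝ k (fun z => 𝒦 z + V z) z‖ ≤ ρ * Real.exp ((∑ i, z i ^ 2) / 4))
    (h𝒦UVb : ∀ k, k ≤ r₀ → ∀ z : Fin d → ℝ,
      ‖iteratedFDeriv ℝ k (fun z => 𝒦 z + U z + V z) z‖ ≤ ρ * Real.exp ((∑ i, z i ^ 2) / 4))
    (hUb : ∀ k, k ≤ r₀ → ∀ z : Fin d → ℝ, ‖iteratedFDeriv ℝ k U z‖ ≤ u * Real.exp ((∑ i, z i ^ 2) / 4))
    (hVb : ∀ k, k ≤ r₀ → ∀ z : Fin d → ℝ, ‖iteratedFDeriv ℝ k V z‖ ≤ v * Real.exp ((∑ i, z i ^ 2) / 4))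
    (hsmall1 : Real.exp (1 / 4) * (ρ * Real.exp (fieldWt h (L : ℝ) d 0 / (L : ℝ) ^ 0)) * A ≤ 1)
    (x y z : HamSpace ℂ d (fieldWt h (L : ℝ) d 0) ((L : ℝ) ^ 0) (L ^ (d * 0)))
    (hx : ‖x‖ ≤ 1 / 64) (hxy : ‖x + y‖ ≤ 1 / 64) (hxz : ‖x + z‖ ≤ 1 / 64) (hxyz : ‖x + y + z‖ ≤ 1 / 64)
    (hsmall : (Real.exp (1 / 4) + 16 * Real.exp (3 / 8) * ‖y‖ + 16 * Real.exp (3 / 8) * ‖z‖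
        + 256 * Real.exp (1 / 4) * ‖y‖ * ‖z‖)
        * ((ρ + u + v) * Real.exp (fieldWt h (L : ℝ) d 0 / (L : ℝ) ^ 0)) * A ≤ 1 / 2) :
    activityNormLE (abkmNormParams L N Mord R p r₀ h θbar A (schedDelta δ₀ δ₁ N) 𝒞) 0
      (initAct (N := N) (Mord := Mord) (R := R) (p := p) (r₀ := r₀) (θbar := θbar) (A := A) (δ₀ := δ₀)
          (δ₁ := δ₁) (𝒞 := 𝒞) (fun w => 𝒦 w + U w + V w) (x + y + z) -
        initAct (N := N) (Mord := Mord) (R := R) (p := p) (r₀ := r₀) (θbar := θbar) (A := A) (δ₀ := δ₀)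
          (δ₁ := δ₁) (𝒞 := 𝒞) (fun w => 𝒦 w + U w) (x + y) -
        initAct (N := N) (Mord := Mord) (R := R) (p := p) (r₀ := r₀) (θbar := θbar) (A := A) (δ₀ := δ₀)
          (δ₁ := δ₁) (𝒞 := 𝒞) (fun w => 𝒦 w + V w) (x + z) +
        initAct (N := N) (Mord := Mord) (R := R) (p := p) (r₀ := r₀) (θbar := θbar) (A := A) (δ₀ := δ₀)
          (δ₁ := δ₁) (𝒞 := 𝒞) 𝒦 x)
      (6 * (16 * Real.exp (3 / 8) * ‖y‖) * (16 * Real.exp (3 / 8) * ‖z‖)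
          * (((ρ + u + v) * Real.exp (fieldWt h (L : ℝ) d 0 / (L : ℝ) ^ 0)) * A) ^ 2
        + (256 * Real.exp (1 / 4) * ‖y‖ * ‖z‖) * (((ρ + u + v) * Real.exp (fieldWt h (L : ℝ) d 0 / (L : ℝ) ^ 0)) * A)
        + 6 * (16 * Real.exp (3 / 8) * ‖y‖) * (v * Real.exp (fieldWt h (L : ℝ) d 0 / (L : ℝ) ^ 0) * A)
        + 6 * (16 * Real.exp (3 / 8) * ‖z‖) * (u * Real.exp (fieldWt h (L : ℝ) d 0 / (L : ℝ) ^ 0) * A)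
        + 6 * u * v * (Real.exp (fieldWt h (L : ℝ) d 0 / (L : ℝ) ^ 0) * Real.exp (1 / 4) * A) ^ 2) := by
  -- coefficient norms of the four seeds and of the increments
  have hnx : ∀ (w : HamSpace ℂ d (fieldWt h (L : ℝ) d 0) ((L : ℝ) ^ 0) (L ^ (d * 0))), ‖w‖ ≤ 1 / 64 →
      hamNorm (fieldWt h (L : ℝ) d 0) ((L : ℝ) ^ 0) (L ^ (d * 0)) (HamSpace.toHam w) ≤ 1 / 16 := by
    intro w hw
    rw [← HamSpace.norm_def]; linarith
  have hmemρ : ∀ (w : HamSpace ℂ d (fieldWt h (L : ℝ) d 0) ((L : ℝ) ^ 0) (L ^ (d * 0))), ‖w‖ ≤ 1 / 64 →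
      ∀ {F : (Fin d → ℝ) → ℂ}, ContDiff ℝ r₀ F →
      (∀ k, k ≤ r₀ → ∀ z : Fin d → ℝ, ‖iteratedFDeriv ℝ k F z‖ ≤ ρ * Real.exp ((∑ i, z i ^ 2) / 4)) →
      restrictConn (L ^ 0) (initKH F (HamSpace.toHam w)) ∈
        activitySpace (abkmNormParams L N Mord R p r₀ h θbar A (schedDelta δ₀ δ₁ N) 𝒞) 0 := by
    intro w hw F hF hFb
    exact restrictConn_initKH_mem_activitySpace hd hLodd hM hp hMord hB hδ₀ hδ₁ hh hh0 hA hF hFb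
      ((hnx w hw).trans (by norm_num)) hsmall1
  have m11 := hmemρ (x + y + z) hxyz ((h𝒦.add hU).add hV) h𝒦UVb
  have m10 := hmemρ (x + y) hxy (h𝒦.add hU) h𝒦Ub
  have m01 := hmemρ (x + z) hxz (h𝒦.add hV) h𝒦Vb
  have m00 := hmemρ x hx h𝒦 h𝒦b
  have hyn : ‖y‖ ≤ 1 / 32 := by
    have h1 : ‖y‖ ≤ ‖x + y‖ + ‖x‖ := by
      calc ‖y‖ = ‖(x + y) - x‖ := by rw [add_sub_cancel_left]
        _ ≤ ‖x + y‖ + ‖x‖ := norm_sub_le _ _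
    linarith
  have hzn : ‖z‖ ≤ 1 / 32 := by
    have h1 : ‖z‖ ≤ ‖x + z‖ + ‖x‖ := by
      calc ‖z‖ = ‖(x + z) - x‖ := by rw [add_sub_cancel_left]
        _ ≤ ‖x + z‖ + ‖x‖ := norm_sub_le _ _
    linarith
  -- the toHam images
  have eY : HamSpace.toHam (x + y) = HamSpace.toHam x + HamSpace.toHam y := map_add _ _ _
  have eZ : HamSpace.toHam (x + z) = HamSpace.toHam x + HamSpace.toHam z := map_add _ _ _
  have eYZ : HamSpace.toHam (x + y + z) = HamSpace.toHam x + HamSpace.toHam y + HamSpace.toHam z := by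
    rw [map_add, map_add]
  have hH := hnx x hx
  have hHY : hamNorm (fieldWt h (L : ℝ) d 0) ((L : ℝ) ^ 0) (L ^ (d * 0)) (HamSpace.toHam x + HamSpace.toHam y) ≤ 1 / 16 := by
    rw [← eY]; exact hnx _ hxy
  have hHZ : hamNorm (fieldWt h (L : ℝ) d 0) ((L : ℝ) ^ 0) (L ^ (d * 0)) (HamSpace.toHam x + HamSpace.toHam z) ≤ 1 / 16 := by
    rw [← eZ]; exact hnx _ hxz
  have hHYZ : hamNorm (fieldWt h (L : ℝ) d 0) ((L : ℝ) ^ 0) (L ^ (d * 0))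
      (HamSpace.toHam x + HamSpace.toHam y + HamSpace.toHam z) ≤ 1 / 16 := by
    rw [← eYZ]; exact hnx _ hxyz
  have hY : hamNorm (fieldWt h (L : ℝ) d 0) ((L : ℝ) ^ 0) (L ^ (d * 0)) (HamSpace.toHam y) ≤ 1 / 32 := by
    rw [← HamSpace.norm_def]; exact hyn
  have hZ : hamNorm (fieldWt h (L : ℝ) d 0) ((L : ℝ) ^ 0) (L ^ (d * 0)) (HamSpace.toHam z) ≤ 1 / 32 := by
    rw [← HamSpace.norm_def]; exact hzn
  have hsmall' : (Real.exp (1 / 4)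
        + 16 * Real.exp (3 / 8) * hamNorm (fieldWt h (L : ℝ) d 0) ((L : ℝ) ^ 0) (L ^ (d * 0)) (HamSpace.toHam y)
        + 16 * Real.exp (3 / 8) * hamNorm (fieldWt h (L : ℝ) d 0) ((L : ℝ) ^ 0) (L ^ (d * 0)) (HamSpace.toHam z)
        + 256 * Real.exp (1 / 4) * hamNorm (fieldWt h (L : ℝ) d 0) ((L : ℝ) ^ 0) (L ^ (d * 0)) (HamSpace.toHam y)
          * hamNorm (fieldWt h (L : ℝ) d 0) ((L : ℝ) ^ 0) (L ^ (d * 0)) (HamSpace.toHam z))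
        * ((ρ + u + v) * Real.exp (fieldWt h (L : ℝ) d 0 / (L : ℝ) ^ 0)) * A ≤ 1 / 2 := by
    rw [← HamSpace.norm_def, ← HamSpace.norm_def]; exact hsmall
  have hweak := weakNormLE_initKH_jointSecondDiff (p := p) (r₀ := r₀) hd hLodd hM hp hMord hB hδ₀ hδ₁ hh hh0 hA
    h𝒦 hU hV h𝒦b hUb hVb hH hHY hHZ hHYZ hY hZ hsmall'
  rw [← HamSpace.norm_def, ← HamSpace.norm_def] at hweak
  unfold activityNormLE
  rw [Submodule.coe_add, Submodule.coe_sub, Submodule.coe_sub, coe_initAct_of_mem m11, coe_initAct_of_mem m10,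
    coe_initAct_of_mem m01, coe_initAct_of_mem m00, eYZ, eY, eZ]
  have hfun : restrictConn (L ^ 0) (initKH (fun w => 𝒦 w + U w + V w) (HamSpace.toHam x + HamSpace.toHam y + HamSpace.toHam z))
        - restrictConn (L ^ 0) (initKH (fun w => 𝒦 w + U w) (HamSpace.toHam x + HamSpace.toHam y))
        - restrictConn (L ^ 0) (initKH (fun w => 𝒦 w + V w) (HamSpace.toHam x + HamSpace.toHam z))
        + restrictConn (L ^ 0) (initKH 𝒦 (HamSpace.toHam x))
      = restrictConn (L ^ 0) (fun X φ =>
          initKH (fun w => 𝒦 w + U w + V w) (HamSpace.toHam x + HamSpace.toHam y + HamSpace.toHam z) X φ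
          - initKH (fun w => 𝒦 w + U w) (HamSpace.toHam x + HamSpace.toHam y) X φ
          - initKH (fun w => 𝒦 w + V w) (HamSpace.toHam x + HamSpace.toHam z) X φ
          + initKH (M := M) 𝒦 (HamSpace.toHam x) X φ) := by
    funext X φ
    simp only [Pi.add_apply, Pi.sub_apply, restrictConn]
    split_ifs with hX
    · rfl
    · simp
  rw [hfun]
  exact weakNormLE_restrictConn_iff.2 hweak

end Bundled

end Literature.MathematicalPhysics.StatisticalMechanics.GradientRG

end
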